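import Summits.Ventures.CertifiedManyBodySolver.Observables.EtaPairingExclusionStrongCouplingQuadrants
import HarnessLib

/-!
# η-PAIRING EXCLUSION AT STRONG COUPLING — THE ELECTRON-DOPED MIRRORS `n ↦ 2 − n`: `U·(n − 1) > 32/π²`, every `U ≥ 0` on
# `7/5 ≤ n < 3/2`, and the quadrants `{U ≥ 4, n ≥ 5/4}`, `{U ≥ 5, n ≥ 6/5}`, `{U ≥ 6, n ≥ 9/8}`, `{U ≥ 8, n ≥ 27/25}`

HONEST FRAMING: exclusions in Yang's staggered `s`-wave (η) pair channel (`Q = (π,π)` on-site pairs) — where nobody expects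
order; NOTHING about `d`-wave pairing or the uniform on-site channel; CTL/dictionary class; REGION-valid at zero solves; a
ceiling never speaks to presence; not a superconductivity verdict; no phase sentence. Crew hubbard-obs (D-0042), seat
hubbard-obs-p1 (`prover-hubbard-obs-p1-g16-0`), PAIRCORR-SDP §24; third file of the g16 strong-coupling set
(`EtaPairingExclusionStrongCoupling` p564638: lever with a margin, filled-band cap, closed form, all `U` on `n ≤ 3/5`;
`EtaPairingExclusionStrongCouplingQuadrants`: density rays, quadrants). ZERO compute; no definition; no `sorry`; claim nodes enter
only BY NAME through the hole-doped theorems being mirrored.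

THE MIRROR (g15, `etaPairing_exclusion_mirror`): Lieb's staggered particle–hole automorphism `α` maps a translation-invariant ground
state of density `2 − m` to one of density `m` (`groundStateClass_particleHole`) with `Re ω(η†_Λ η_Λ) = Re (ω∘α)(η†_Λ η_Λ) + (1 − m)|Λ|`;
the `O(|Λ|)` commutator term is invisible at the ODLRO scale `|Λ|²`. Every hole-doped region theorem with an `ω`-independent margin
therefore holds at the reflected density with the same margin. Results (every `t' = 0` TI ground state `ω` of density `n`;
`M⁻⁴ Re ω(η†_{Λ_M} η_{Λ_M}) → 0` and `Re ω(η†_Λ η_Λ) ≤ 64(|Λ'| − |Λ|)²/margin² + (n − 1)|Λ|`):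
* §1 `U·(n − 1) > 32/π²` (`1 < n < 2`; premise-free), and the AF-HF-plane refinement `U·(n − 1.0192790474) > 2.4615882554`;
* §2 every `U ≥ 0` on `7/5 ≤ n < 3/2` (premise-free; with g15's `n ≥ 3/2`: every `U` for every `n ≥ 7/5`);
* §3 the quadrants `{U ≥ 4, 5/4 ≤ n < 2}`, `{U ≥ 5, 6/5 ≤ n < 2}`, `{U ≥ 6, 9/8 ≤ n < 2}`, `{U ≥ 8, 9/8 ≤ n < 2}` (explicit margins) and
  `{U ≥ 8, 27/25 ≤ n < 2}` (margin `U − 2μ₊(2 − n; U) > 0`), floors BY NAME as in the Quadrants file.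
THE FULL `t' = 0` MAP (g13–g16): η-pairing ODLRO is ABSENT whenever `|n − 1| ≥ 2/5` (every `U ≥ 0`; `U > 0` if `|n − 1| > 1/2`),
on `{U ≥ 4, |n − 1| ≥ 1/4}`, `{U ≥ 5, |n − 1| ≥ 1/5}`, `{U ≥ 6, |n − 1| ≥ 1/8}`, `{U ≥ 8, |n − 1| ≥ 2/25}`, whenever `U·|n − 1| > 32/π²`, on the
cell rays and
inside the weak-coupling windows; at every density `n ≠ 1` the undecided couplings form a BOUNDED interval.

CITATION FORM: as the companion files — nearest prior art Yang–Zhang 1990 Thms 10–11 / Fig. 3; [folklore: Yang 1989 commutator +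
Bratteli–Robinson ground-state stability + Lieb 1989 particle–hole map]; the `[cite:]` tags name the INGREDIENTS. References:
C. N. Yang, PRL 63 (1989) 2144, eqs. (6)–(8) [Yang1989]; E. H. Lieb, PRL 62 (1989) 1201 [LiebPRL1989]; C. N. Yang, S. C. Zhang,
Mod. Phys. Lett. B 4 (1990) 759, Thm. 1 [YangZhang1990]; O. Bratteli, D. W. Robinson, OAQSM 2 (1997) Prop. 5.3.19
[BratteliRobinsonII1997]; E. H. Lieb, F. Y. Wu, Physica A 321 (2003) 1, §7 [LiebWuPhysicaA2003].
-/

noncomputable section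

namespace Summit.Ventures.CertifiedManyBodySolver.Observables

open Matrix Finset Filter Literature.MathematicalPhysics.QuantumLattice Literature.Probability.LatticeModels
open Literature.MathematicalPhysics.QuantumLattice.HubbardWave0 ThermodynamicLimit
open Summit.Ventures.CertifiedManyBodySolver.Certificates
open scoped ComplexOrder Topology

/-! ### §1 Mirror of the closed-form region: `U·(n − 1) > 32/π²` -/

/-- **`U·(n − 1) > 32/π²` (`1 < n < 2`) EXCLUDES η-PAIRING ODLRO** (premise-free): for every TI ground state `ω` of density `n`,
`M⁻⁴ Re ω(η†η) → 0` and `Re ω(η†_Λ η_Λ) ≤ 64(|Λ'| − |Λ|)²/(U − 32/(π²(n − 1)))² + (n − 1)|Λ|`.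
[cite: LiebPRL1989, proof of Theorem 2] [cite: Yang1989, eqs. (6)–(8)] [cite: BratteliRobinsonII1997, Prop. 5.3.19] -/
theorem etaPairing_exclusion_of_strongCoupling_electronDoped {U n : ℝ} (hU : 0 ≤ U) (hn1 : 1 < n) (hn2 : n < 2)
    (hs : 32 / Real.pi ^ 2 < U * (n - 1))
    {ω : InfVolFermionState 2} (hω : ω.IsTranslationInvariant) (hρ : ω.density = n)
    (hme : ω.meanEnergy (hubbardTTPrimeFermionInteraction 1 0 U) 1 = energyDensityTT' 1 0 U n) :
    Tendsto (fun M : ℕ =>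
        (ω.expect (halfOpenBox 2 M) (etaRaise (fun w : PolySite (halfOpenBox 2 M) => siteStagger (ofLex w.1)) *
          etaLower (fun w : PolySite (halfOpenBox 2 M) => siteStagger (ofLex w.1)))).re / (M : ℝ) ^ 4)
        atTop (𝓝 0) ∧
      ∀ {Λ Λ' : Finset (Site 2)}, Λ ⊆ Λ' → thicken Λ 1 ⊆ Λ' →
        (ω.expect Λ (etaRaise (fun w : PolySite Λ => siteStagger (ofLex w.1)) *
            etaLower (fun w : PolySite Λ => siteStagger (ofLex w.1)))).re ≤
          64 * ((#Λ' : ℝ) - #Λ) ^ 2 / (U - 32 / (Real.pi ^ 2 * (n - 1))) ^ 2 + (n - 1) * #Λ := by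
  have hm0 : 0 < 2 - n := by linarith
  have hm2 : 2 - n < 2 := by linarith
  have hs' : 32 / Real.pi ^ 2 < U * (1 - (2 - n)) := by rwa [show (1 : ℝ) - (2 - n) = n - 1 by ring]
  have h := etaPairing_exclusion_mirror (c := U - 32 / (Real.pi ^ 2 * (n - 1))) hU hm0 hm2
    (fun hω' hρ' hme' => by
      have h1 := etaPairing_exclusion_of_strongCoupling hU hm0 (by linarith) hs' hω' hρ' hme'
      rwa [show (1 : ℝ) - (2 - n) = n - 1 by ring] at h1)
    (ω := ω) hω (by rw [hρ]; ring) (by rw [hme]; congr 1; ring)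
  rw [show (1 : ℝ) - (2 - n) = n - 1 by ring] at h
  exact h

/-- **Decimal form**: `3.2423 ≤ U(n − 1)` (`1 < n < 2`) suffices. [cite: LiebPRL1989, proof of Theorem 2] [cite: Yang1989, eqs. (6)–(8)] -/
theorem etaPairing_exclusion_of_strongCoupling_electronDoped_decimal {U n : ℝ} (hU : 0 ≤ U) (hn1 : 1 < n) (hn2 : n < 2)
    (hs : (3.2423 : ℝ) ≤ U * (n - 1))
    {ω : InfVolFermionState 2} (hω : ω.IsTranslationInvariant) (hρ : ω.density = n)
    (hme : ω.meanEnergy (hubbardTTPrimeFermionInteraction 1 0 U) 1 = energyDensityTT' 1 0 U n) :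
    Tendsto (fun M : ℕ =>
        (ω.expect (halfOpenBox 2 M) (etaRaise (fun w : PolySite (halfOpenBox 2 M) => siteStagger (ofLex w.1)) *
          etaLower (fun w : PolySite (halfOpenBox 2 M) => siteStagger (ofLex w.1)))).re / (M : ℝ) ^ 4)
        atTop (𝓝 0) ∧
      ∀ {Λ Λ' : Finset (Site 2)}, Λ ⊆ Λ' → thicken Λ 1 ⊆ Λ' →
        (ω.expect Λ (etaRaise (fun w : PolySite Λ => siteStagger (ofLex w.1)) *
            etaLower (fun w : PolySite Λ => siteStagger (ofLex w.1)))).re ≤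
          64 * ((#Λ' : ℝ) - #Λ) ^ 2 / (U - 32 / (Real.pi ^ 2 * (n - 1))) ^ 2 + (n - 1) * #Λ := by
  have h32 : 32 / Real.pi ^ 2 < (3.2423 : ℝ) := by
    have h := sixteen_div_pi_sq_lt_decimal
    have hπ : (0 : ℝ) < Real.pi ^ 2 := by positivity
    rw [div_lt_iff₀ hπ] at h ⊢
    linarith
  exact etaPairing_exclusion_of_strongCoupling_electronDoped hU hn1 hn2 (by linarith) hω hρ hme

/-- **Mirror of the AF-HF-plane region: `U·(n − 1.0192790474) > 2.4615882554` (`1 < n < 2`) excludes η-pairing ODLRO**, margin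
`U − 2(1.2307941277 + 0.0096395237·U)/(n − 1)` (e.g. `n = 9/8`: every `U ≥ 23.29`). [cite: LiebPRL1989, proof of Theorem 2]
[cite: Yang1989, eqs. (6)–(8)] [cite: BachLiebSolovej1994, eq. (2c.36)] -/
theorem etaPairing_exclusion_of_strongCoupling_afhf20_electronDoped {U n : ℝ} (hU : 0 ≤ U) (hn1 : 1 < n) (hn2 : n < 2)
    (hs : (2.4615882554 : ℝ) < U * (n - 1.0192790474))
    {ω : InfVolFermionState 2} (hω : ω.IsTranslationInvariant) (hρ : ω.density = n)
    (hme : ω.meanEnergy (hubbardTTPrimeFermionInteraction 1 0 U) 1 = energyDensityTT' 1 0 U n) :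
    Tendsto (fun M : ℕ =>
        (ω.expect (halfOpenBox 2 M) (etaRaise (fun w : PolySite (halfOpenBox 2 M) => siteStagger (ofLex w.1)) *
          etaLower (fun w : PolySite (halfOpenBox 2 M) => siteStagger (ofLex w.1)))).re / (M : ℝ) ^ 4)
        atTop (𝓝 0) ∧
      ∀ {Λ Λ' : Finset (Site 2)}, Λ ⊆ Λ' → thicken Λ 1 ⊆ Λ' →
        (ω.expect Λ (etaRaise (fun w : PolySite Λ => siteStagger (ofLex w.1)) *
            etaLower (fun w : PolySite Λ => siteStagger (ofLex w.1)))).re ≤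
          64 * ((#Λ' : ℝ) - #Λ) ^ 2 / (U - 2 * ((1.2307941277 + 0.0096395237 * U) / (n - 1))) ^ 2 + (n - 1) * #Λ := by
  have hm0 : 0 < 2 - n := by linarith
  have hm2 : 2 - n < 2 := by linarith
  have hs' : (2.4615882554 : ℝ) < U * (0.9807209526 - (2 - n)) := by
    rwa [show (0.9807209526 : ℝ) - (2 - n) = n - 1.0192790474 by ring]
  have h := etaPairing_exclusion_mirror (c := U - 2 * ((1.2307941277 + 0.0096395237 * U) / (n - 1))) hU hm0 hm2
    (fun hω' hρ' hme' => by
      have h1 := etaPairing_exclusion_of_strongCoupling_afhf20 hU hm0 (by linarith) hs' hω' hρ' hme'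
      rwa [show (1 : ℝ) - (2 - n) = n - 1 by ring] at h1)
    (ω := ω) hω (by rw [hρ]; ring) (by rw [hme]; congr 1; ring)
  rw [show (1 : ℝ) - (2 - n) = n - 1 by ring] at h
  exact h

/-! ### §2 Mirror of the all-`U` slab: every `U ≥ 0` on `7/5 ≤ n < 3/2` -/

/-- **η-PAIRING ODLRO IS ABSENT AT EVERY `U ≥ 0` FOR EVERY `7/5 ≤ n < 3/2`** (premise-free): bound
`64(|Λ'| − |Λ|)²/(U − 2μ₊(2 − n; U))² + (n − 1)|Λ|` with `U − 2μ₊(2 − n; U) > 0`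
(`sub_two_mul_chemPotPlusTT'_pos_of_half_lt_of_le_threeFifths` at the reflected density). With g15's
`…_of_gt_threeHalvesFilling` / `…_threeHalvesFilling`: every `U` for EVERY `n ≥ 7/5`. [cite: LiebPRL1989, proof of Theorem 2]
[cite: Yang1989, eqs. (6)–(8)] [cite: BratteliRobinsonII1997, Prop. 5.3.19] -/
theorem etaPairing_exclusion_of_sevenFifths_le_of_lt_threeHalves {U n : ℝ} (hU : 0 ≤ U) (hn : 7 / 5 ≤ n) (hn' : n < 3 / 2)
    {ω : InfVolFermionState 2} (hω : ω.IsTranslationInvariant) (hρ : ω.density = n)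
    (hme : ω.meanEnergy (hubbardTTPrimeFermionInteraction 1 0 U) 1 = energyDensityTT' 1 0 U n) :
    Tendsto (fun M : ℕ =>
        (ω.expect (halfOpenBox 2 M) (etaRaise (fun w : PolySite (halfOpenBox 2 M) => siteStagger (ofLex w.1)) *
          etaLower (fun w : PolySite (halfOpenBox 2 M) => siteStagger (ofLex w.1)))).re / (M : ℝ) ^ 4)
        atTop (𝓝 0) ∧
      ∀ {Λ Λ' : Finset (Site 2)}, Λ ⊆ Λ' → thicken Λ 1 ⊆ Λ' →
        (ω.expect Λ (etaRaise (fun w : PolySite Λ => siteStagger (ofLex w.1)) *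
            etaLower (fun w : PolySite Λ => siteStagger (ofLex w.1)))).re ≤
          64 * ((#Λ' : ℝ) - #Λ) ^ 2 / (U - 2 * chemPotPlusTT' 1 0 U (2 - n)) ^ 2 + (n - 1) * #Λ := by
  have hm0 : 0 < 2 - n := by linarith
  have hm2 : 2 - n < 2 := by linarith
  have h := etaPairing_exclusion_mirror (c := U - 2 * chemPotPlusTT' 1 0 U (2 - n)) hU hm0 hm2
    (fun hω' hρ' hme' =>
      etaPairing_exclusion_of_half_lt_of_le_threeFifths hU (by linarith) (by linarith) hω' hρ' hme')
    (ω := ω) hω (by rw [hρ]; ring) (by rw [hme]; congr 1; ring)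
  rw [show (1 : ℝ) - (2 - n) = n - 1 by ring] at h
  exact h

/-! ### §3 Mirrors of the quadrants -/

/-- **QUADRANT `{U ≥ 4, 5/4 ≤ n < 2}`** (mirror of `{U ≥ 4, n ≤ 3/4}`; floor node at `(4, 3/4)` BY NAME): bound
`64(|Λ'| − |Λ|)²/(0.1907687224·U − 0.463649764)² + (n − 1)|Λ|`. [cite: LiebPRL1989, proof of Theorem 2] [cite: Yang1989, eqs. (6)–(8)] -/
theorem etaPairing_exclusion_quadrant_n5o4_electronDoped
    (h518 : DerivedNTangent34R426.derived_r426_ntangent_sq_U4_n3o4_tp0) {U n : ℝ} (hU4 : 4 ≤ U) (hn : 5 / 4 ≤ n) (hn2 : n < 2)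
    {ω : InfVolFermionState 2} (hω : ω.IsTranslationInvariant) (hρ : ω.density = n)
    (hme : ω.meanEnergy (hubbardTTPrimeFermionInteraction 1 0 U) 1 = energyDensityTT' 1 0 U n) :
    Tendsto (fun M : ℕ =>
        (ω.expect (halfOpenBox 2 M) (etaRaise (fun w : PolySite (halfOpenBox 2 M) => siteStagger (ofLex w.1)) *
          etaLower (fun w : PolySite (halfOpenBox 2 M) => siteStagger (ofLex w.1)))).re / (M : ℝ) ^ 4)
        atTop (𝓝 0) ∧
      ∀ {Λ Λ' : Finset (Site 2)}, Λ ⊆ Λ' → thicken Λ 1 ⊆ Λ' →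
        (ω.expect Λ (etaRaise (fun w : PolySite Λ => siteStagger (ofLex w.1)) *
            etaLower (fun w : PolySite Λ => siteStagger (ofLex w.1)))).re ≤
          64 * ((#Λ' : ℝ) - #Λ) ^ 2 / (0.1907687224 * U - 0.463649764) ^ 2 + (n - 1) * #Λ := by
  have hm0 : 0 < 2 - n := by linarith
  have hm2 : 2 - n < 2 := by linarith
  have h := etaPairing_exclusion_mirror (c := 0.1907687224 * U - 0.463649764) (by linarith) hm0 hm2
    (fun hω' hρ' hme' => etaPairing_exclusion_quadrant_n3o4 h518 hU4 hm0 (by linarith) hω' hρ' hme')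
    (ω := ω) hω (by rw [hρ]; ring) (by rw [hme]; congr 1; ring)
  rw [show (1 : ℝ) - (2 - n) = n - 1 by ring] at h
  exact h

/-- **QUADRANT `{U ≥ 5, 6/5 ≤ n < 2}`** (mirror of `{U ≥ 5, n ≤ 4/5}`; floor nodes BY NAME): bound
`64(|Λ'| − |Λ|)²/(0.21079012·U − 0.620668091)² + (n − 1)|Λ|`. [cite: LiebPRL1989, proof of Theorem 2] [cite: Yang1989, eqs. (6)–(8)] -/
theorem etaPairing_exclusion_quadrant_n6o5_electronDoped
    (h512 : DerivedNTangent45R426.derived_r426_ntangent_sq_U4_n4o5_tp0)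
    (h515 : cert_r515_HYB_GU8n4o5eom8_w3_b4_R2_ob5p2_kry1_kry2c3rel_menulite_core_twin_focert_it6000)
    {U n : ℝ} (hU5 : 5 ≤ U) (hn : 6 / 5 ≤ n) (hn2 : n < 2)
    {ω : InfVolFermionState 2} (hω : ω.IsTranslationInvariant) (hρ : ω.density = n)
    (hme : ω.meanEnergy (hubbardTTPrimeFermionInteraction 1 0 U) 1 = energyDensityTT' 1 0 U n) :
    Tendsto (fun M : ℕ =>
        (ω.expect (halfOpenBox 2 M) (etaRaise (fun w : PolySite (halfOpenBox 2 M) => siteStagger (ofLex w.1)) *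
          etaLower (fun w : PolySite (halfOpenBox 2 M) => siteStagger (ofLex w.1)))).re / (M : ℝ) ^ 4)
        atTop (𝓝 0) ∧
      ∀ {Λ Λ' : Finset (Site 2)}, Λ ⊆ Λ' → thicken Λ 1 ⊆ Λ' →
        (ω.expect Λ (etaRaise (fun w : PolySite Λ => siteStagger (ofLex w.1)) *
            etaLower (fun w : PolySite Λ => siteStagger (ofLex w.1)))).re ≤
          64 * ((#Λ' : ℝ) - #Λ) ^ 2 / (0.21079012 * U - 0.620668091) ^ 2 + (n - 1) * #Λ := by
  have hm0 : 0 < 2 - n := by linarith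
  have hm2 : 2 - n < 2 := by linarith
  have h := etaPairing_exclusion_mirror (c := 0.21079012 * U - 0.620668091) (by linarith) hm0 hm2
    (fun hω' hρ' hme' => etaPairing_exclusion_quadrant_n4o5 h512 h515 hU5 hm0 (by linarith) hω' hρ' hme')
    (ω := ω) hω (by rw [hρ]; ring) (by rw [hme]; congr 1; ring)
  rw [show (1 : ℝ) - (2 - n) = n - 1 by ring] at h
  exact h

/-- **QUADRANT `{U ≥ 8, 9/8 ≤ n < 2}`** (mirror of `{U ≥ 8, n ≤ 7/8}`; node #505 BY NAME): bound
`64(|Λ'| − |Λ|)²/(0.1866751072·U + 0.6347382512)² + (n − 1)|Λ|` — the A0′ electron-doped twin `(8, 9/8)` of g15 extended to the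
whole quadrant. [cite: LiebPRL1989, proof of Theorem 2] [cite: Yang1989, eqs. (6)–(8)] -/
theorem etaPairing_exclusion_quadrant_n9o8_electronDoped
    (h505 : cert_r505_HYB_GU8n7o8eom8_w3_b4_R2_ob5p2_kry1_kry2c3rel_menulite_core_focert_it2000)
    {U n : ℝ} (hU8 : 8 ≤ U) (hn : 9 / 8 ≤ n) (hn2 : n < 2)
    {ω : InfVolFermionState 2} (hω : ω.IsTranslationInvariant) (hρ : ω.density = n)
    (hme : ω.meanEnergy (hubbardTTPrimeFermionInteraction 1 0 U) 1 = energyDensityTT' 1 0 U n) :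
    Tendsto (fun M : ℕ =>
        (ω.expect (halfOpenBox 2 M) (etaRaise (fun w : PolySite (halfOpenBox 2 M) => siteStagger (ofLex w.1)) *
          etaLower (fun w : PolySite (halfOpenBox 2 M) => siteStagger (ofLex w.1)))).re / (M : ℝ) ^ 4)
        atTop (𝓝 0) ∧
      ∀ {Λ Λ' : Finset (Site 2)}, Λ ⊆ Λ' → thicken Λ 1 ⊆ Λ' →
        (ω.expect Λ (etaRaise (fun w : PolySite Λ => siteStagger (ofLex w.1)) *
            etaLower (fun w : PolySite Λ => siteStagger (ofLex w.1)))).re ≤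
          64 * ((#Λ' : ℝ) - #Λ) ^ 2 / (0.1866751072 * U + 0.6347382512) ^ 2 + (n - 1) * #Λ := by
  have hm0 : 0 < 2 - n := by linarith
  have hm2 : 2 - n < 2 := by linarith
  have h := etaPairing_exclusion_mirror (c := 0.1866751072 * U + 0.6347382512) (by linarith) hm0 hm2
    (fun hω' hρ' hme' => etaPairing_exclusion_quadrant_n7o8 h505 hU8 hm0 (by linarith) hω' hρ' hme')
    (ω := ω) hω (by rw [hρ]; ring) (by rw [hme]; congr 1; ring)
  rw [show (1 : ℝ) - (2 - n) = n - 1 by ring] at h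
  exact h

/-- **QUADRANT `{U ≥ 6, 9/8 ≤ n < 2}`** (mirror of `{U ≥ 6, n ≤ 7/8}`; SIGNED node #542 BY NAME): bound
`64(|Λ'| − |Λ|)²/0.33² + (n − 1)|Λ|`. [cite: LiebPRL1989, proof of Theorem 2] [cite: Yang1989, eqs. (6)–(8)] -/
theorem etaPairing_exclusion_quadrant_n9o8_of_six_le_electronDoped
    (h542 : cert_r542_bs_GU6n7o8tp0_w3_b4_R2_ob5p2_kry1_kry2c3rel_hanK7B4D4_KN4_PR20d4_hanK8c2s_uprime)
    {U n : ℝ} (hU6 : 6 ≤ U) (hn : 9 / 8 ≤ n) (hn2 : n < 2)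
    {ω : InfVolFermionState 2} (hω : ω.IsTranslationInvariant) (hρ : ω.density = n)
    (hme : ω.meanEnergy (hubbardTTPrimeFermionInteraction 1 0 U) 1 = energyDensityTT' 1 0 U n) :
    Tendsto (fun M : ℕ =>
        (ω.expect (halfOpenBox 2 M) (etaRaise (fun w : PolySite (halfOpenBox 2 M) => siteStagger (ofLex w.1)) *
          etaLower (fun w : PolySite (halfOpenBox 2 M) => siteStagger (ofLex w.1)))).re / (M : ℝ) ^ 4)
        atTop (𝓝 0) ∧
      ∀ {Λ Λ' : Finset (Site 2)}, Λ ⊆ Λ' → thicken Λ 1 ⊆ Λ' →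
        (ω.expect Λ (etaRaise (fun w : PolySite Λ => siteStagger (ofLex w.1)) *
            etaLower (fun w : PolySite Λ => siteStagger (ofLex w.1)))).re ≤
          64 * ((#Λ' : ℝ) - #Λ) ^ 2 / (0.33 : ℝ) ^ 2 + (n - 1) * #Λ := by
  have hm0 : 0 < 2 - n := by linarith
  have hm2 : 2 - n < 2 := by linarith
  have h := etaPairing_exclusion_mirror (c := (0.33 : ℝ)) (by linarith) hm0 hm2
    (fun hω' hρ' hme' => etaPairing_exclusion_quadrant_n7o8_of_six_le h542 hU6 hm0 (by linarith) hω' hρ' hme')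
    (ω := ω) hω (by rw [hρ]; ring) (by rw [hme]; congr 1; ring)
  rw [show (1 : ℝ) - (2 - n) = n - 1 by ring] at h
  exact h

/-- **QUADRANT `{U ≥ 8, 27/25 ≤ n < 2}`** (mirror of `{U ≥ 8, n ≤ 23/25}`; node #534 BY NAME): `M⁻⁴ Re ω(η†η) → 0` and
`Re ω(η†_Λ η_Λ) ≤ 64(|Λ'| − |Λ|)²/(U − 2μ₊(2 − n; U))² + (n − 1)|Λ|`, with `U − 2μ₊(2 − n; U) > 0`.
[cite: LiebPRL1989, proof of Theorem 2] [cite: Yang1989, eqs. (6)–(8)] [cite: BratteliRobinsonII1997, Prop. 5.3.19] -/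
theorem etaPairing_exclusion_of_eight_le_of_twentyseven_div_twentyfive_le_electronDoped
    (h534 : DerivedNTangentR529SymN.derived_r529_ntangent_sq_U8_msym_tp0) {U n : ℝ} (hU8 : 8 ≤ U) (hn : 27 / 25 ≤ n)
    (hn2 : n < 2)
    {ω : InfVolFermionState 2} (hω : ω.IsTranslationInvariant) (hρ : ω.density = n)
    (hme : ω.meanEnergy (hubbardTTPrimeFermionInteraction 1 0 U) 1 = energyDensityTT' 1 0 U n) :
    0 < U - 2 * chemPotPlusTT' 1 0 U (2 - n) ∧
    Tendsto (fun M : ℕ =>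
        (ω.expect (halfOpenBox 2 M) (etaRaise (fun w : PolySite (halfOpenBox 2 M) => siteStagger (ofLex w.1)) *
          etaLower (fun w : PolySite (halfOpenBox 2 M) => siteStagger (ofLex w.1)))).re / (M : ℝ) ^ 4)
        atTop (𝓝 0) ∧
      ∀ {Λ Λ' : Finset (Site 2)}, Λ ⊆ Λ' → thicken Λ 1 ⊆ Λ' →
        (ω.expect Λ (etaRaise (fun w : PolySite Λ => siteStagger (ofLex w.1)) *
            etaLower (fun w : PolySite Λ => siteStagger (ofLex w.1)))).re ≤
          64 * ((#Λ' : ℝ) - #Λ) ^ 2 / (U - 2 * chemPotPlusTT' 1 0 U (2 - n)) ^ 2 + (n - 1) * #Λ := by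
  have hU : 0 ≤ U := by linarith
  have hm0 : 0 < 2 - n := by linarith
  have hm2 : 2 - n < 2 := by linarith
  have hm' : 2 - n ≤ 23 / 25 := by linarith
  -- positivity of the reflected margin, from the hole-doped theorem applied to ANY state of the class is not needed:
  -- it is a statement about `μ₊` only
  have hpos : 0 < U - 2 * chemPotPlusTT' 1 0 U (2 - n) := by
    rcases le_total (2 - n) (7 / 8) with h78 | h78
    · obtain ⟨hm, hle⟩ := sub_two_mul_chemPotPlusTT'_pos_of_eight_le_of_le_twentythree_div_twentyfive h534 hU8
        (le_refl (7 / 8 : ℝ)) (by norm_num)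
      exact lt_of_lt_of_le hm (sub_two_mul_chemPotPlusTT'_mono_density hU hm0 h78 (by norm_num) hle)
    · obtain ⟨hm, hle⟩ := sub_two_mul_chemPotPlusTT'_pos_of_eight_le_of_le_twentythree_div_twentyfive h534 hU8 h78 hm'
      exact lt_of_lt_of_le hm hle
  have h := etaPairing_exclusion_mirror (c := U - 2 * chemPotPlusTT' 1 0 U (2 - n)) hU hm0 hm2
    (fun hω' hρ' hme' => (etaPairing_exclusion_of_eight_le_of_le_twentythree_div_twentyfive h534 hU8 hm0 hm' hω' hρ' hme').2)
    (ω := ω) hω (by rw [hρ]; ring) (by rw [hme]; congr 1; ring)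
  rw [show (1 : ℝ) - (2 - n) = n - 1 by ring] at h
  exact ⟨hpos, h⟩

end Summit.Ventures.CertifiedManyBodySolver.Observables
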